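import Literature.Probability.RandomMatrixProducts.AndersonModel1D
import Mathlib.MeasureTheory.Integral.IntegrableOn
import Mathlib.MeasureTheory.Measure.Prod
import Mathlib.Analysis.SpecialFunctions.Pow.Real
import HarnessLib

/-!
# Elementary estimates for the Anderson transfer matrices: growth, perturbation, block splitting, negative moments

Companion to `AndersonModel1D.lean` (Bucaj–Damanik–Fillman–Gerbuz–VandenBoom–Wang–Zhang, TAMS
**372** (2019), arXiv:1706.06135, §§2–3).  Everything here is PROVED; it is the deterministic and
measure-theoretic plumbing with which the vendored facts of that file (Fürstenberg positivity,
Thm 2.3; vectorwise uniform large deviations, Prop. 3.6) are turned into exponential decay of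
negative moments `𝔼 ‖M_n v‖^{-s}`, uniformly over compact parameter sets — the form in which
localisation enters transport bounds (first consumer: the high-frequency part of the
Ajanki–Huveneers scaling law, `Literature/Barriers/AtomisticToContinuum/`).

* Growth / co-growth (`‖M^E(α) v‖ ≤ (|E-α|+1)‖v‖`, `‖v‖ ≤ (|E-α|+1)‖M^E(α) v‖`, hence
  `(D+1)^{-n}‖v‖ ≤ ‖M_n v‖ ≤ (D+1)^n ‖v‖` when `|E - α_k| ≤ D`; the constant `Γ` of §3).
* Perturbation in the potential (the `ω`-part of Lemma 3.3):
  `‖M_n(α) - M_n(β)‖ ≤ n δ (D+1)^n` if `|α_k - β_k| ≤ δ`.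
* The cocycle identity over concatenated samples `M_{p+q}(x ⧺ y) = M_q(y) M_p(x)` and the block
  splitting `∫ f dμ^{⊗(p+q)} = ∫∫ f(x ⧺ y) dμ^{⊗q}(y) dμ^{⊗p}(x)` (the independence step in the
  proof of Prop. 3.6).
* `e^{-y} ≤ 1 - y + y²` (`|y| ≤ 1`) and its consequence: `∫ g ≥ 1`, `|g| ≤ B` a.e. imply
  `∫ e^{-g/(2B²)} ≤ 1 - 1/(4B²)`; and the passage from a block contraction
  `a(n+N) ≤ θ a(n)` to exponential decay.
-/

noncomputable section

open MeasureTheory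
open scoped Matrix.Norms.L2Operator Matrix

namespace Literature.Probability.RandomMatrixProducts

/-- The quadratic-form inequality behind `‖M^E(α)‖ ≤ |E - α| + 1`:
`(d x₀ - x₁)² + x₀² ≤ (|d| + 1)² (x₀² + x₁²)`. [folklore] -/
theorem transfer_quadratic_bound (d x₀ x₁ : ℝ) :
    (d * x₀ - x₁) ^ 2 + x₀ ^ 2 ≤ (|d| + 1) ^ 2 * (x₀ ^ 2 + x₁ ^ 2) := by
  rcases le_or_gt 0 d with hd | hd
  · rw [abs_of_nonneg hd]
    have key : (d + 1) ^ 2 * (x₀ ^ 2 + x₁ ^ 2) - ((d * x₀ - x₁) ^ 2 + x₀ ^ 2) =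
        d * ((x₀ + x₁) ^ 2 + x₀ ^ 2 + (d + 1) * x₁ ^ 2) := by ring
    nlinarith [mul_nonneg hd (add_nonneg (add_nonneg (sq_nonneg (x₀ + x₁)) (sq_nonneg x₀))
      (mul_nonneg (by linarith : (0:ℝ) ≤ d + 1) (sq_nonneg x₁)))]
  · rw [abs_of_neg hd]
    have key : (-d + 1) ^ 2 * (x₀ ^ 2 + x₁ ^ 2) - ((d * x₀ - x₁) ^ 2 + x₀ ^ 2) =
        (-d) * ((x₀ - x₁) ^ 2 + x₀ ^ 2 + (-d + 1) * x₁ ^ 2) := by ring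
    nlinarith [mul_nonneg (by linarith : (0:ℝ) ≤ -d) (add_nonneg (add_nonneg (sq_nonneg (x₀ - x₁)) (sq_nonneg x₀))
      (mul_nonneg (by linarith : (0:ℝ) ≤ -d + 1) (sq_nonneg x₁)))]

/-- Coordinates of `M^E(α) v`: `((E - α) v₀ - v₁, v₀)`. [cite: BucajEtAl2019, Def. 2.2] -/
theorem andersonTransfer_toEuclideanLin_apply (E α : ℝ) (v : EuclideanSpace ℝ (Fin 2)) :
    (Matrix.toEuclideanLin (andersonTransfer E α) v) 0 = (E - α) * v 0 - v 1 ∧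
    (Matrix.toEuclideanLin (andersonTransfer E α) v) 1 = v 0 := by
  constructor
  · show ((andersonTransfer E α) *ᵥ v.ofLp) 0 = _
    simp [Matrix.mulVec, dotProduct, Fin.sum_univ_two]
    ring
  · show ((andersonTransfer E α) *ᵥ v.ofLp) 1 = _
    simp [Matrix.mulVec, dotProduct, Fin.sum_univ_two]

/-- `‖M^E(α) v‖ ≤ (|E - α| + 1) ‖v‖`. [folklore] -/
theorem norm_andersonTransfer_apply_le (E α : ℝ) (v : EuclideanSpace ℝ (Fin 2)) :
    ‖Matrix.toEuclideanLin (andersonTransfer E α) v‖ ≤ (|E - α| + 1) * ‖v‖ := by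
  have h0 : 0 ≤ |E - α| + 1 := by positivity
  have nsq : ∀ x : EuclideanSpace ℝ (Fin 2), ‖x‖ ^ 2 = x 0 ^ 2 + x 1 ^ 2 := fun x => by
    rw [EuclideanSpace.norm_sq_eq]; simp [Fin.sum_univ_two]
  rw [← abs_of_nonneg (norm_nonneg _), ← abs_of_nonneg (mul_nonneg h0 (norm_nonneg v)), ← sq_le_sq,
    mul_pow, nsq, nsq, (andersonTransfer_toEuclideanLin_apply E α v).1,
    (andersonTransfer_toEuclideanLin_apply E α v).2]
  exact transfer_quadratic_bound (E - α) (v 0) (v 1)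

/-- `‖v‖ ≤ (|E - α| + 1) ‖M^E(α) v‖` (`M^E(α)⁻¹ = [[0, 1],[-1, E - α]]` has the same norm). [folklore] -/
theorem norm_le_norm_andersonTransfer_apply (E α : ℝ) (v : EuclideanSpace ℝ (Fin 2)) :
    ‖v‖ ≤ (|E - α| + 1) * ‖Matrix.toEuclideanLin (andersonTransfer E α) v‖ := by
  have h0 : 0 ≤ |E - α| + 1 := by positivity
  have nsq : ∀ x : EuclideanSpace ℝ (Fin 2), ‖x‖ ^ 2 = x 0 ^ 2 + x 1 ^ 2 := fun x => by
    rw [EuclideanSpace.norm_sq_eq]; simp [Fin.sum_univ_two]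
  rw [← abs_of_nonneg (norm_nonneg v), ← abs_of_nonneg (mul_nonneg h0 (norm_nonneg _)), ← sq_le_sq,
    mul_pow, nsq, nsq, (andersonTransfer_toEuclideanLin_apply E α v).1,
    (andersonTransfer_toEuclideanLin_apply E α v).2]
  have := transfer_quadratic_bound (E - α) (v 0) ((E - α) * v 0 - v 1)
  nlinarith [this]

/-- `‖M^E(α)‖ ≤ |E - α| + 1` (Euclidean operator norm). [folklore] -/
theorem norm_andersonTransfer_le (E α : ℝ) : ‖andersonTransfer E α‖ ≤ |E - α| + 1 := by
  rw [Matrix.l2_opNorm_def]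
  refine ContinuousLinearMap.opNorm_le_bound _ (by positivity) fun v => ?_
  exact norm_andersonTransfer_apply_le E α v

/-- `toEuclideanLin` is multiplicative (matrix product ↦ composition). [folklore] -/
theorem toEuclideanLin_mul_apply (A B : Matrix (Fin 2) (Fin 2) ℝ) (v : EuclideanSpace ℝ (Fin 2)) :
    Matrix.toEuclideanLin (A * B) v = Matrix.toEuclideanLin A (Matrix.toEuclideanLin B v) := by
  apply PiLp.ext
  intro i
  show ((A * B) *ᵥ v.ofLp) i = (A *ᵥ (B *ᵥ v.ofLp)) i
  rw [Matrix.mulVec_mulVec]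

/-- **Growth and co-growth of the transfer products**: if `|E - α_k| ≤ D` for `k < n` then
`‖M_n v‖ ≤ (D+1)^n ‖v‖` and `‖v‖ ≤ (D+1)^n ‖M_n v‖`. [cite: BucajEtAl2019, §3 (the constant `Γ`, display (3.3))] -/
theorem norm_andersonTransferProd_apply_bounds (E : ℝ) {D : ℝ} (hD : 0 ≤ D) (α : ℕ → ℝ)
    (v : EuclideanSpace ℝ (Fin 2)) :
    ∀ n, (∀ k, k < n → |E - α k| ≤ D) →
      ‖Matrix.toEuclideanLin (andersonTransferProd E α n) v‖ ≤ (D + 1) ^ n * ‖v‖ ∧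
      ‖v‖ ≤ (D + 1) ^ n * ‖Matrix.toEuclideanLin (andersonTransferProd E α n) v‖
  | 0, _ => by simp
  | n + 1, h => by
    obtain ⟨ih1, ih2⟩ := norm_andersonTransferProd_apply_bounds E hD α v n fun k hk => h k (by omega)
    have hn : |E - α n| ≤ D := h n (by omega)
    have hD1 : (0 : ℝ) ≤ (D + 1) ^ n := by positivity
    rw [andersonTransferProd_succ, toEuclideanLin_mul_apply]
    constructor
    · calc ‖Matrix.toEuclideanLin (andersonTransfer E (α n)) (Matrix.toEuclideanLin (andersonTransferProd E α n) v)‖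
          ≤ (|E - α n| + 1) * ‖Matrix.toEuclideanLin (andersonTransferProd E α n) v‖ :=
            norm_andersonTransfer_apply_le _ _ _
        _ ≤ (D + 1) * ((D + 1) ^ n * ‖v‖) := by gcongr
        _ = (D + 1) ^ (n + 1) * ‖v‖ := by ring
    · calc ‖v‖ ≤ (D + 1) ^ n * ‖Matrix.toEuclideanLin (andersonTransferProd E α n) v‖ := ih2
        _ ≤ (D + 1) ^ n * ((|E - α n| + 1) *
              ‖Matrix.toEuclideanLin (andersonTransfer E (α n)) (Matrix.toEuclideanLin (andersonTransferProd E α n) v)‖) := by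
            gcongr
            exact norm_le_norm_andersonTransfer_apply _ _ _
        _ ≤ (D + 1) ^ n * ((D + 1) *
              ‖Matrix.toEuclideanLin (andersonTransfer E (α n)) (Matrix.toEuclideanLin (andersonTransferProd E α n) v)‖) := by
            gcongr
        _ = (D + 1) ^ (n + 1) * _ := by ring

/-- Operator-norm growth `‖M_n‖ ≤ (D+1)^n`. [cite: BucajEtAl2019, §3 (display (3.3))] -/
theorem norm_andersonTransferProd_le (E : ℝ) {D : ℝ} (hD : 0 ≤ D) (α : ℕ → ℝ) :
    ∀ n, (∀ k, k < n → |E - α k| ≤ D) → ‖andersonTransferProd E α n‖ ≤ (D + 1) ^ n := by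
  intro n h
  rw [Matrix.l2_opNorm_def]
  refine ContinuousLinearMap.opNorm_le_bound _ (by positivity) fun v => ?_
  exact (norm_andersonTransferProd_apply_bounds E hD α v n h).1

/-- **Concatenation**: `M_{n+N}(β) = M_N(β(n + ·)) · M_n(β)`. [cite: BucajEtAl2019, §3 (proof of Prop. 3.6, the cocycle identity)] -/
theorem andersonTransferProd_add (E : ℝ) (β : ℕ → ℝ) (n : ℕ) :
    ∀ N, andersonTransferProd E β (n + N) =
      andersonTransferProd E (fun j => β (n + j)) N * andersonTransferProd E β n
  | 0 => by simp
  | N + 1 => by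
    rw [← Nat.add_assoc, andersonTransferProd_succ, andersonTransferProd_add E β n N,
      andersonTransferProd_succ, Matrix.mul_assoc]

/-- A matrix with a single non-zero entry `c` at `(0,0)` maps `v` to `(c v₀, 0)`, of norm
`≤ |c| ‖v‖`. [folklore] -/
theorem norm_single_entry_apply_le (c : ℝ) (v : EuclideanSpace ℝ (Fin 2)) :
    ‖Matrix.toEuclideanLin (!![c, 0; 0, 0] : Matrix (Fin 2) (Fin 2) ℝ) v‖ ≤ |c| * ‖v‖ := by
  have h1 : (Matrix.toEuclideanLin (!![c, 0; 0, 0] : Matrix (Fin 2) (Fin 2) ℝ) v) 0 = c * v 0 := by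
    show ((!![c, 0; 0, 0] : Matrix (Fin 2) (Fin 2) ℝ) *ᵥ v.ofLp) 0 = _
    simp [Matrix.mulVec, dotProduct, Fin.sum_univ_two]
  have h2 : (Matrix.toEuclideanLin (!![c, 0; 0, 0] : Matrix (Fin 2) (Fin 2) ℝ) v) 1 = 0 := by
    show ((!![c, 0; 0, 0] : Matrix (Fin 2) (Fin 2) ℝ) *ᵥ v.ofLp) 1 = _
    simp [Matrix.mulVec, dotProduct, Fin.sum_univ_two]
  have nsq : ∀ x : EuclideanSpace ℝ (Fin 2), ‖x‖ ^ 2 = x 0 ^ 2 + x 1 ^ 2 := fun x => by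
    rw [EuclideanSpace.norm_sq_eq]; simp [Fin.sum_univ_two]
  rw [← abs_of_nonneg (norm_nonneg _), ← abs_of_nonneg (mul_nonneg (abs_nonneg c) (norm_nonneg v)),
    ← sq_le_sq, mul_pow, nsq, nsq, h1, h2, sq_abs]
  nlinarith [sq_nonneg c, sq_nonneg (v 1), mul_nonneg (sq_nonneg c) (sq_nonneg (v 1))]

/-- The operator norm of a matrix with a single non-zero entry `c` at `(0,0)` is at most `|c|`. [folklore] -/
theorem norm_single_entry_le (c : ℝ) : ‖(!![c, 0; 0, 0] : Matrix (Fin 2) (Fin 2) ℝ)‖ ≤ |c| := by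
  rw [Matrix.l2_opNorm_def]
  refine ContinuousLinearMap.opNorm_le_bound _ (abs_nonneg c) fun v => ?_
  exact norm_single_entry_apply_le c v

/-- `M^E(α) - M^E(β)` has the single entry `β - α`. [cite: BucajEtAl2019, Lemma 3.3 (its one-step input)] -/
theorem andersonTransfer_sub (E α β : ℝ) :
    andersonTransfer E α - andersonTransfer E β = !![β - α, 0; 0, 0] := by
  ext i j
  fin_cases i <;> fin_cases j <;> simp [andersonTransfer]

/-- **Perturbation in the potential** (the `ω`-part of Bucaj et al. Lemma 3.3): if
`|E - α_k|, |E - β_k| ≤ D` and `|α_k - β_k| ≤ δ` for `k < n`, then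
`‖M_n(α) - M_n(β)‖ ≤ n δ (D+1)^n`. [cite: BucajEtAl2019, Lemma 3.3] -/
theorem norm_andersonTransferProd_sub_le (E : ℝ) {D δ : ℝ} (hD : 0 ≤ D) (hδ : 0 ≤ δ) (α β : ℕ → ℝ) :
    ∀ n, (∀ k, k < n → |E - α k| ≤ D) → (∀ k, k < n → |E - β k| ≤ D) →
      (∀ k, k < n → |α k - β k| ≤ δ) →
      ‖andersonTransferProd E α n - andersonTransferProd E β n‖ ≤ n * δ * (D + 1) ^ n
  | 0, _, _, _ => by simp
  | n + 1, hα, hβ, hd => by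
    have ih := norm_andersonTransferProd_sub_le E hD hδ α β n (fun k hk => hα k (by omega))
      (fun k hk => hβ k (by omega)) (fun k hk => hd k (by omega))
    have hMβ := norm_andersonTransferProd_le E hD β n fun k hk => hβ k (by omega)
    have hA : ‖andersonTransfer E (α n)‖ ≤ D + 1 :=
      (norm_andersonTransfer_le E (α n)).trans (by linarith [hα n (by omega)])
    have hAB : ‖andersonTransfer E (α n) - andersonTransfer E (β n)‖ ≤ δ := by
      rw [andersonTransfer_sub]
      refine (norm_single_entry_le _).trans ?_
      rw [abs_sub_comm]
      exact hd n (by omega)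
    have hD1 : (1 : ℝ) ≤ D + 1 := by linarith
    have hpow : (D + 1) ^ n ≤ (D + 1) ^ (n + 1) := pow_le_pow_right₀ hD1 (Nat.le_succ n)
    have eq : andersonTransferProd E α (n + 1) - andersonTransferProd E β (n + 1) =
        andersonTransfer E (α n) * (andersonTransferProd E α n - andersonTransferProd E β n) +
          (andersonTransfer E (α n) - andersonTransfer E (β n)) * andersonTransferProd E β n := by
      rw [andersonTransferProd_succ, andersonTransferProd_succ]
      noncomm_ring
    rw [eq]
    calc _ ≤ ‖andersonTransfer E (α n) * (andersonTransferProd E α n - andersonTransferProd E β n)‖ +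
          ‖(andersonTransfer E (α n) - andersonTransfer E (β n)) * andersonTransferProd E β n‖ :=
          norm_add_le _ _
      _ ≤ ‖andersonTransfer E (α n)‖ * ‖andersonTransferProd E α n - andersonTransferProd E β n‖ +
          ‖andersonTransfer E (α n) - andersonTransfer E (β n)‖ * ‖andersonTransferProd E β n‖ :=
          add_le_add (Matrix.l2_opNorm_mul _ _) (Matrix.l2_opNorm_mul _ _)
      _ ≤ (D + 1) * (n * δ * (D + 1) ^ n) + δ * (D + 1) ^ n := by
          gcongr
      _ ≤ (D + 1) * (n * δ * (D + 1) ^ n) + δ * (D + 1) ^ (n + 1) := by gcongr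
      _ = ((n + 1 : ℕ) : ℝ) * δ * (D + 1) ^ (n + 1) := by push_cast; ring

/-- Log-Lipschitz: for `x, y ≥ c > 0`, `|log x - log y| ≤ |x - y| / c`. [folklore] -/
theorem abs_log_sub_log_le {x y c : ℝ} (hc : 0 < c) (hx : c ≤ x) (hy : c ≤ y) :
    |Real.log x - Real.log y| ≤ |x - y| / c := by
  have hx0 : 0 < x := hc.trans_le hx
  have hy0 : 0 < y := hc.trans_le hy
  rw [abs_le]
  constructor
  · -- log y - log x ≤ |x - y|/c
    have h1 : Real.log y - Real.log x ≤ (y - x) / x := by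
      rw [← Real.log_div hy0.ne' hx0.ne']
      have := Real.log_le_sub_one_of_pos (div_pos hy0 hx0)
      rwa [div_sub_one hx0.ne'] at this
    have h2 : (y - x) / x ≤ |x - y| / c := by
      rw [div_le_div_iff₀ hx0 hc]
      calc (y - x) * c ≤ |x - y| * c := by
            gcongr
            rw [abs_sub_comm]; exact le_abs_self _
        _ ≤ |x - y| * x := by gcongr
    linarith
  · have h1 : Real.log x - Real.log y ≤ (x - y) / y := by
      rw [← Real.log_div hx0.ne' hy0.ne']
      have := Real.log_le_sub_one_of_pos (div_pos hx0 hy0)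
      rwa [div_sub_one hy0.ne'] at this
    have h2 : (x - y) / y ≤ |x - y| / c := by
      rw [div_le_div_iff₀ hy0 hc]
      calc (x - y) * c ≤ |x - y| * c := by gcongr; exact le_abs_self _
        _ ≤ |x - y| * y := by gcongr
    linarith


/-! ### Measure-theoretic plumbing: splitting an i.i.d. sample into two blocks -/

/-- **Block splitting of an i.i.d. sample** (Tonelli over the first `p` and the last `q` sites):
`∫ f dμ^{⊗(p+q)} = ∫ (∫ f(x ⧺ y) dμ^{⊗q}(y)) dμ^{⊗p}(x)`, the i.i.d. law of `p + q` sites being the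
image of the product of the block laws under `Fin.append`. [folklore] -/
theorem lintegral_pi_fin_add (μ : Measure ℝ) [SigmaFinite μ] (p q : ℕ)
    {f : (Fin (p + q) → ℝ) → ENNReal} (hf : Measurable f) :
    ∫⁻ z, f z ∂(Measure.pi fun _ : Fin (p + q) => μ) =
      ∫⁻ x, ∫⁻ y, f (Fin.append x y) ∂(Measure.pi fun _ : Fin q => μ) ∂(Measure.pi fun _ : Fin p => μ) := by
  let e : ((Fin p → ℝ) × (Fin q → ℝ)) ≃ᵐ (Fin (p + q) → ℝ) :=
    (MeasurableEquiv.sumPiEquivProdPi (fun _ : Fin p ⊕ Fin q => ℝ)).symm.trans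
      (MeasurableEquiv.piCongrLeft (fun _ : Fin (p + q) => ℝ) finSumFinEquiv)
  have he_apply : ∀ (x : Fin p → ℝ) (y : Fin q → ℝ), e (x, y) = Fin.append x y := by
    intro x y
    funext i
    rcases finSumFinEquiv.surjective i with ⟨s, rfl⟩
    simp only [e, MeasurableEquiv.trans_apply, MeasurableEquiv.coe_piCongrLeft, Equiv.piCongrLeft_apply_apply]
    rcases s with i₀ | j₀
    · rw [finSumFinEquiv_apply_left, Fin.append_left]
      rfl
    · rw [finSumFinEquiv_apply_right, Fin.append_right]
      rfl
  have he : MeasurePreserving e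
      ((Measure.pi fun _ : Fin p => μ).prod (Measure.pi fun _ : Fin q => μ))
      (Measure.pi fun _ : Fin (p + q) => μ) :=
    (measurePreserving_sumPiEquivProdPi_symm (fun _ : Fin p ⊕ Fin q => μ)).trans
      (measurePreserving_piCongrLeft (fun _ : Fin (p + q) => μ) finSumFinEquiv)
  rw [← he.lintegral_comp hf]
  have := lintegral_prod (μ := Measure.pi fun _ : Fin p => μ) (ν := Measure.pi fun _ : Fin q => μ)
    (fun z => f (e z)) (hf.comp e.measurable).aemeasurable
  rw [this]
  simp_rw [he_apply]

/-- Padding of an appended sample: the first block. [folklore] -/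
theorem padSeq_append_of_lt {p q : ℕ} (x : Fin p → ℝ) (y : Fin q → ℝ) {k : ℕ} (hk : k < p) :
    padSeq (Fin.append x y) k = padSeq x k := by
  rw [padSeq_of_lt _ (by omega : k < p + q), padSeq_of_lt _ hk]
  exact Fin.append_left x y ⟨k, hk⟩

/-- Padding of an appended sample: the second block. [folklore] -/
theorem padSeq_append_add {p q : ℕ} (x : Fin p → ℝ) (y : Fin q → ℝ) {j : ℕ} (hj : j < q) :
    padSeq (Fin.append x y) (p + j) = padSeq y j := by
  rw [padSeq_of_lt _ (by omega : p + j < p + q), padSeq_of_lt _ hj]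
  exact Fin.append_right x y ⟨j, hj⟩

/-- **Cocycle over an appended sample**: `M_{p+q}(x ⧺ y) = M_q(y) · M_p(x)`.
[cite: BucajEtAl2019, §3 (proof of Prop. 3.6, the cocycle identity)] -/
theorem andersonTransferProd_append (E : ℝ) {p q : ℕ} (x : Fin p → ℝ) (y : Fin q → ℝ) :
    andersonTransferProd E (padSeq (Fin.append x y)) (p + q) =
      andersonTransferProd E (padSeq y) q * andersonTransferProd E (padSeq x) p := by
  rw [andersonTransferProd_add]
  congr 1
  · exact andersonTransferProd_congr E q fun k hk => padSeq_append_add x y hk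
  · exact andersonTransferProd_congr E p fun k hk => padSeq_append_of_lt x y hk

/-- For a scaled/transformed sample only the first `n` values matter: `M_n(padSeq (g ∘ α))`
agrees with `M_n` of any sequence with the same first `n` values. [folklore] -/
theorem andersonTransferProd_padSeq_eq (E : ℝ) {n : ℕ} (α : Fin n → ℝ) (β : ℕ → ℝ)
    (h : ∀ k (hk : k < n), β k = α ⟨k, hk⟩) :
    andersonTransferProd E β n = andersonTransferProd E (padSeq α) n :=
  andersonTransferProd_congr E n fun k hk => by rw [h k hk, padSeq_of_lt α hk]

/-! ### Continuity and measurability in the sample -/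

/-- `α ↦ M_n(α) v` is continuous. [folklore] -/
theorem continuous_andersonTransferProd_apply (E : ℝ) {n : ℕ} (k : ℕ) (v : EuclideanSpace ℝ (Fin 2)) :
    Continuous fun α : Fin n → ℝ => Matrix.toEuclideanLin (andersonTransferProd E (padSeq α) k) v := by
  have hM := continuous_andersonTransferProd E (n := n) k
  show Continuous fun α : Fin n → ℝ => WithLp.toLp 2 ((andersonTransferProd E (padSeq α) k) *ᵥ v.ofLp)
  refine (PiLp.continuous_toLp 2 _).comp ?_
  refine continuous_pi fun i => ?_
  simp only [Matrix.mulVec, dotProduct, Fin.sum_univ_two]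
  have h1 : ∀ i j, Continuous fun α : Fin n → ℝ => andersonTransferProd E (padSeq α) k i j :=
    fun i j => (continuous_apply j).comp ((continuous_apply i).comp hM)
  fun_prop

/-- `α ↦ ‖M_n(α) v‖` is measurable. [folklore] -/
theorem measurable_norm_andersonTransferProd_apply (E : ℝ) {n : ℕ} (k : ℕ) (v : EuclideanSpace ℝ (Fin 2)) :
    Measurable fun α : Fin n → ℝ => ‖Matrix.toEuclideanLin (andersonTransferProd E (padSeq α) k) v‖ :=
  (continuous_andersonTransferProd_apply E k v).norm.measurable


/-! ### From a log-moment lower bound to a negative-moment contraction -/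

/-- `e^{-y} ≤ 1 - y + y²` for `|y| ≤ 1`. [folklore] -/
theorem exp_neg_le_one_sub_add_sq {y : ℝ} (hy : |y| ≤ 1) : Real.exp (-y) ≤ 1 - y + y ^ 2 := by
  have h := Real.abs_exp_sub_one_sub_id_le (x := -y) (by rwa [abs_neg])
  have h2 := (abs_le.mp h).2
  nlinarith [h2]

/-- **Negative moments from log-moments** (the elementary step turning `𝔼 log‖M_N v‖ ≥ 1` into a
contraction of `𝔼 ‖M_N v‖^{-s}`): if `P` is a probability measure, `g` is measurable with
`|g| ≤ B` a.e. (`B ≥ 1`) and `∫ g dP ≥ 1`, then for `s = 1/(2B²)`,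
`∫ e^{-s g} dP ≤ 1 - s/2`. [folklore] -/
theorem integral_exp_neg_mul_le {S : Type*} [MeasurableSpace S] (P : Measure S) [IsProbabilityMeasure P]
    {g : S → ℝ} (hg : Measurable g) {B : ℝ} (hB : 1 ≤ B) (hbound : ∀ᵐ x ∂P, |g x| ≤ B)
    (hmean : 1 ≤ ∫ x, g x ∂P) :
    ∫ x, Real.exp (-(1 / (2 * B ^ 2) * g x)) ∂P ≤ 1 - (1 / (2 * B ^ 2)) / 2 := by
  set s : ℝ := 1 / (2 * B ^ 2) with hs
  have hB0 : 0 < B := by linarith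
  have hs0 : 0 < s := by positivity
  have hsB : s * B ≤ 1 := by
    rw [hs, div_mul_eq_mul_div, one_mul, div_le_one (by positivity)]
    nlinarith
  have hgi : Integrable g P := by
    refine Integrable.of_bound hg.aestronglyMeasurable B ?_
    filter_upwards [hbound] with x hx
    rw [Real.norm_eq_abs]
    exact hx
  -- pointwise bound a.e.
  have hpt : ∀ᵐ x ∂P, Real.exp (-(s * g x)) ≤ 1 - s * g x + s ^ 2 * B ^ 2 := by
    filter_upwards [hbound] with x hx
    have hy : |s * g x| ≤ 1 := by
      rw [abs_mul, abs_of_pos hs0]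
      calc s * |g x| ≤ s * B := by gcongr
        _ ≤ 1 := hsB
    calc Real.exp (-(s * g x)) ≤ 1 - s * g x + (s * g x) ^ 2 := exp_neg_le_one_sub_add_sq hy
      _ ≤ 1 - s * g x + s ^ 2 * B ^ 2 := by
        have h1 : |g x| ^ 2 ≤ B ^ 2 := pow_le_pow_left₀ (abs_nonneg _) hx 2
        rw [sq_abs] at h1
        nlinarith [h1, sq_nonneg s]
  have hexp_meas : Measurable fun x => Real.exp (-(s * g x)) := by fun_prop
  have hexp_int : Integrable (fun x => Real.exp (-(s * g x))) P := by
    refine Integrable.of_bound hexp_meas.aestronglyMeasurable (Real.exp 1) ?_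
    filter_upwards [hbound] with x hx
    rw [Real.norm_eq_abs, abs_of_pos (Real.exp_pos _)]
    apply Real.exp_le_exp.mpr
    have : |s * g x| ≤ 1 := by
      rw [abs_mul, abs_of_pos hs0]
      calc s * |g x| ≤ s * B := by gcongr
        _ ≤ 1 := hsB
    linarith [(abs_le.mp this).1]
  have hrhs_int : Integrable (fun x => 1 - s * g x + s ^ 2 * B ^ 2) P :=
    ((integrable_const 1).sub (hgi.const_mul s)).add (integrable_const _)
  calc ∫ x, Real.exp (-(s * g x)) ∂P ≤ ∫ x, (1 - s * g x + s ^ 2 * B ^ 2) ∂P :=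
        integral_mono_ae hexp_int hrhs_int hpt
    _ = 1 - s * ∫ x, g x ∂P + s ^ 2 * B ^ 2 := by
        have e1 : ∫ x, (1 - s * g x + s ^ 2 * B ^ 2) ∂P =
            ∫ x, (1 - s * g x) ∂P + ∫ _x, s ^ 2 * B ^ 2 ∂P :=
          integral_add ((integrable_const 1).sub (hgi.const_mul s)) (integrable_const _)
        have e2 : ∫ x, (1 - s * g x) ∂P = ∫ _x, (1 : ℝ) ∂P - ∫ x, s * g x ∂P :=
          integral_sub (integrable_const 1) (hgi.const_mul s)
        rw [e1, e2, integral_const_mul, integral_const, integral_const]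
        simp
    _ ≤ 1 - s * 1 + s ^ 2 * B ^ 2 := by nlinarith [hmean, hs0]
    _ = 1 - s / 2 := by
        have : s ^ 2 * B ^ 2 = s / 2 := by
          rw [hs]; field_simp
        rw [this]; ring

/-- From a block contraction to exponential decay: if `a(n + N) ≤ θ a(n)` for all `n` and
`a(n) ≤ A` for `n < N`, with `0 < θ < 1`, then `a(n) ≤ (A/θ) e^{-(-log θ / N) n}`. [folklore] -/
theorem decay_of_block_contraction {a : ℕ → ENNReal} {N : ℕ} (hN : 1 ≤ N) {θ A : ℝ} (hθ0 : 0 < θ)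
    (hθ1 : θ < 1) (hA : 0 ≤ A) (hstep : ∀ n, a (n + N) ≤ ENNReal.ofReal θ * a n)
    (hinit : ∀ n, n < N → a n ≤ ENNReal.ofReal A) (n : ℕ) :
    a n ≤ ENNReal.ofReal (A / θ * Real.exp (-(-Real.log θ / N * n))) := by
  -- first: a n ≤ ofReal A * ofReal θ ^ (n / N)
  have key : ∀ n, a n ≤ ENNReal.ofReal A * ENNReal.ofReal θ ^ (n / N) := by
    intro n
    induction n using Nat.strong_induction_on with
    | _ n ih =>
      rcases lt_or_ge n N with hn | hn
      · rw [Nat.div_eq_of_lt hn, pow_zero, mul_one]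
        exact hinit n hn
      · obtain ⟨n', rfl⟩ : ∃ n', n = n' + N := ⟨n - N, by omega⟩
        have hN0 : 0 < N := hN
        rw [Nat.add_div_right _ hN0, pow_succ]
        calc a (n' + N) ≤ ENNReal.ofReal θ * a n' := hstep n'
          _ ≤ ENNReal.ofReal θ * (ENNReal.ofReal A * ENNReal.ofReal θ ^ (n' / N)) := by
              gcongr
              exact ih n' (by omega)
          _ = ENNReal.ofReal A * (ENNReal.ofReal θ ^ (n' / N) * ENNReal.ofReal θ) := by ring
  refine (key n).trans ?_
  -- compare θ^(n/N) with e^{-c n}/θ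
  have hq : ((n : ℝ) / N - 1) ≤ ((n / N : ℕ) : ℝ) := by
    have h1 : (N : ℝ) * (n / N : ℕ) + (n % N : ℕ) = n := by exact_mod_cast Nat.div_add_mod n N
    have h2 : ((n % N : ℕ) : ℝ) < N := by exact_mod_cast Nat.mod_lt n hN
    have hNpos : (0 : ℝ) < N := by exact_mod_cast hN
    rw [div_sub_one hNpos.ne', div_le_iff₀ hNpos]
    nlinarith
  have hpow : θ ^ (n / N) ≤ θ ^ ((n : ℝ) / N - 1) := by
    rw [← Real.rpow_natCast]
    exact Real.rpow_le_rpow_of_exponent_ge hθ0 hθ1.le hq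
  have hexp : θ ^ ((n : ℝ) / N - 1) = 1 / θ * Real.exp (-(-Real.log θ / N * n)) := by
    rw [Real.rpow_def_of_pos hθ0,
      show Real.log θ * ((n : ℝ) / N - 1) = -(-Real.log θ / N * n) + -Real.log θ by ring,
      Real.exp_add, Real.exp_neg (Real.log θ), Real.exp_log hθ0]
    ring
  rw [← ENNReal.ofReal_pow hθ0.le, ← ENNReal.ofReal_mul hA]
  apply ENNReal.ofReal_le_ofReal
  calc A * θ ^ (n / N) ≤ A * θ ^ ((n : ℝ) / N - 1) := by gcongr
    _ = A / θ * Real.exp (-(-Real.log θ / N * n)) := by rw [hexp]; ring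

end Literature.Probability.RandomMatrixProducts

end
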